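import Mathlib
import HarnessLib
import HarnessLib.Audit
import Summits.MatrixMultiplication.Statement
import Literature.Computability.AlgebraicComplexity.AsymptoticSpectrum
import Literature.Computability.AlgebraicComplexity.MatrixMultiplicationExponent
import Literature.Computability.AlgebraicComplexity.SchoenhageTau
import Literature.Computability.AlgebraicComplexity.AsymptoticRankMatMul
import HarnessLib.Audit.Status.Attr

/-!
Route: NonabelianARC

DORMANT since 2026-08-23T11:29:36Z (reconciler: no traction for 6.1 d (last activity statement-grounded at 2026-08-17T08:42:09Z); parked, not closed — `ledger route dormant route-MatrixMultiplication-NonabelianARC --off` to reactivate) — unstaffed, not closed; items shared with open routes are served there. `ledger route dormant <id> --off` reactivates.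

# Route NonabelianARC — connected irreducible symmetry forces flatness — NA-ARC on the
matrix-multiplication + SL2 Clebsch–Gordan (3j) ladder

X = NA-ARC ON THE LADDER (realises card nonabelian-arc-symmetry-flatness, its only card). NA-ARC
(non-abelian asymptotic rank
conjecture): a concise tensor T ∈ V₁⊗V₂⊗V₃ whose CONNECTED stabiliser G_T⁰ ⊂ GL(V₁)×GL(V₂)×GL(V₃)
acts IRREDUCIBLY on every leg has
asymptotic rank R~(T) = max dim Vᵢ. X is NA-ARC on the explicit, Lean-typeable ladder of such
tensors: X = X_MaMu ∧ X_J, where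
X_MaMu: for all n ≥ 1, R~(⟨n,n,n⟩) = n² (G⁰ = GL_n³ acting on M_n = ℂⁿ⊗ℂⁿ*; equivalent to ω = 2 by
R~(⟨n,n,n⟩) = n^ω, PROVED in tree),
and X_J: for all l ≥ 1, R~(J_l) = 2l+1, where J_l ∈ (ℂ^(2l+1))^⊗3 is the SL₂-invariant (3j /
Clebsch–Gordan diagonal) tensor in
V_2l ⊗ V_2l ⊗ V_2l, written in closed integer form as the coefficient tensor of the bracket monomial
([12][23][31])^l:
J_l(a,b,c) = [a+b+c = 3l] · Σ_t (−1)^(t+a+b) C(l,t) C(l,t+b−l) C(l,t+l−a). Rungs: J_1 = −ε₃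
(Levi-Civita = T_skewcw,2, G⁰ ⊇ SL₃),
J_2 = polarised J-invariant of binary quartics = det on traceless symmetric 3×3 matrices = ⟨3,3,3⟩
restricted to Sym²₀ (G⁰ = SO₃ ≅ PSL₂,
5×5×5), J_3 = the G₂-invariant 3-form on ℂ⁷ (7×7×7), … . Only X_MaMu feeds the summit; X_J is the
ω-independent test bed of the principle.
Lean: `let J : (l : ℕ) → Fin (2 * l + 1) → Fin (2 * l + 1) → Fin (2 * l + 1) → ℂ := fun l a b c =>
if a.val + b.val + c.val = 3 * l then ∑ t ∈ Finset.range (l + 1), (if l ≤ t + b.val ∧ a.val ≤ t + l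
then (-1 : ℂ) ^ (t + a.val + b.val) * ((Nat.choose l t * Nat.choose l (t + b.val - l) * Nat.choose l
(t + l - a.val) : ℕ) : ℂ) else 0) else 0; (∀ n : ℕ, 1 ≤ n →
Literature.Computability.AlgebraicComplexity.asymptoticRank
(Literature.Computability.AlgebraicComplexity.matMulTensor ℂ n n n) = (n : ℝ) ^ 2) ∧ (∀ l : ℕ, 1 ≤ l
→ Literature.Computability.AlgebraicComplexity.asymptoticRank (J l) = 2 * (l : ℝ) + 1)`

## Assembly
Provable now from the cone, and PROVED in the planner's Sketch.lean (theorem assembly_provable, rc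
0): from X take X_MaMu at n = 2,
R~(⟨2,2,2⟩) = 4; the tree's asymptoticRank_matMulTensor (AsymptoticRankMatMul.lean,
AlmanDuanVassilevskaWilliamsXuXuZhou2025 §3.4) gives
R~(⟨2,2,2⟩) = 2^ω(ℂ), so 2^ω = 2² and ω(ℂ) = 2 by injectivity of x ↦ 2^x
(Real.rpow_le_rpow_left_iff), which is MatrixMultiplication
(MatrixMultiplication_iff). X_J is not used by the assembly: it is the falsifiable content of the
line.

Rationale: WHY THIS LINE. Strassen's asymptotic rank conjecture (tight concise T ⇒ R~(T) = dim;
ConnerGesmundoLandsbergVenturaWang2020 Conj. 1.3, BurgisserClausenShokrollahi1997 Probl. 15.5)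
implies ω = 2 but is now under pressure: it is inconsistent with the Set Cover Conjecture through
explicit tight 0/1 tensors (Björklund–Kaski arXiv:2310.11926: the 7×7×7 tensor Q; Pratt
arXiv:2311.02774: balanced tripartition tensors T_k, SCC ⇒ R~(T_k) > (8−ε)^k ≫ C(3k,k)). This route
bets on the one structural feature separating matrix multiplication from every (conditionally) hard
witness — a connected stabiliser acting irreducibly on each leg — and files the sharpened conjecture
where it is checkable: exact linear algebra run this session shows g_Q is solvable (3-torus ⋉ 3
nilpotent lowering operators, fixes the line e_∅) and g_(T_2) is the tightness torus, so both SCC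
witnesses fall OUTSIDE the class, while ⟨n,n,n⟩, ε₃/det₃ and all J_l fall inside (dim g_J: 10 = sl₃,
5 = sl₂, 16 = g₂, 5; each acting irreducibly, Burnside check). By Schur, irreducibility forces
scalar quantum marginals, so the class consists of critical (polystable) tensors on which every
quantum functional equals max dᵢ (ChristandlVranaZuiddam2023): no known spectral point can obstruct
X, and unstable tensors (UnstableTensorBarrier) are excluded by construction. Imported areas:
invariant theory of SL₂ (Clebsch–Gordan / symbolic method gives the integer ladder J_l and its
border-rank data: bR(J_2) = 8 by a Koszul flattening of rank 45 plus Alexander–Hirschowitz, bR(J_3)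
≥ 13), Lie-algebra stabiliser computations (ConnerGesmundoLandsbergVenturaWang2020 §2.1/§4
'propagation of symmetries'), Kronecker-power border-rank technology
(ConnerGesmundoLandsbergVentura2022: det₃ = ε₃^⊠2, bR 17 < 25) and, as the intended engine for upper
bounds on powers, border apolarity with the Fixed Ideal Theorem for the growing Borel B_T^N
(BuczynskaBuczynski2021, ConnerHarperLandsberg2019). Unlike route AsymptoticSpectrum (structure of Δ
for all tensors), AsymptoticRankCW (cw₂ / det₃ as intermediates) and SchurWeylEquivariant
(S_N-symmetry of the power, not G_T), this line conditions flatness on the symmetry OF THE TENSOR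
and supplies an ω-independent, refutable ladder; negatives index empty at filing.

RANKED CRUXES. #0 NAARCLadder (target) — X = X_MaMu ∧ X_J as in § Thesis: R~(⟨n,n,n⟩) = n² for all n
≥ 1 and R~(J_l) = 2l+1 for all l ≥ 1 (J_l inlined by the closed formula; card items C1 + the MaMu
instance). (why it might fail: a dark (non-quantum) spectral point may ignore symmetry; or NA-ARC
may inherit SCC-inconsistency through an efficient degeneration of J- /MaMu-powers onto Q or T_k; X_J
is far stronger than ω = 2 (bR(J_3) ≥ 13 vs 7).) [ConnerGesmundoLandsbergVenturaWang2020,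
arXiv:2310.11926, arXiv:2311.02774, ChristandlVranaZuiddam2023, Strassen1991]
#2 ThreeJTwoFlat (crux) — the first ω-independent NA-ARC instance: R~(J_2) = 5 for the 5×5×5 tensor
J_2 (polarised cubic J-invariant of binary quartics = det of the traceless symmetric 3×3 matrix =
⟨3,3,3⟩|Sym²₀; card item C1). Known 5 ≤ R~(J_2) ≤ bR(J_2) = 8; tight with uniform marginals, so
Q~(J_2) = 5 = every F^θ(J_2). [difficulty: open-problem] (why it might fail: any value in (5, 8] is
consistent with all known bounds; no exact 'R~ = flattening rank < bR' theorem exists for ANY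
tensor; upper-bound tools are only border ranks of small powers and Alman–Li speed-ups; a spectral
point > 5 at J_2 kills it and NA-ARC.) [ConnerGesmundoLandsbergVenturaWang2020,
ConnerGesmundoLandsbergVentura2022, AlmanLi2026, ChristandlVranaZuiddam2023, arXiv:2601.21553]
#3 Det3Flat (crux) — the l = 1 rung in its det₃ form, SHARED verbatim with route AsymptoticRankCW
(BDet3AsymptoticRank): R~(det₃) = 9 for det₃ = ε₃ ⊠ ε₃ ∈ (ℂ⁹)^⊗3; equivalent to R~(J_1) = R~(ε₃) = 3
by R~(t ⊠ t) = R~(t)² (Fekete/limit form, in tree), and it implies ω = 2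
(ConnerGesmundoLandsbergVentura2022 Prop. 2.2). Here G⁰ = SL₃×SL₃ acts irreducibly on ℂ³⊗ℂ³.
[difficulty: open-problem] (why it might fail: only 9 ≤ R~(det₃) ≤ bR(det₃) = 17 is known
(ConnerHarperLandsberg2019, ConnerHuangLandsberg2020); '= 9' forces ω = 2, so ω > 2 or any spectral
point > 3 at ε₃ refutes it; border rank may be multiplicative from the square on.)
[ConnerGesmundoLandsbergVentura2022, ConnerHarperLandsberg2019, ConnerHuangLandsberg2020,
arXiv:1909.04785]
#4 LeviCivitaBelowFour (crux) — sign of life on the shared rung: R~(ε₃) < 4, i.e. strictly below the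
record √17 ≈ 4.123 given by bR(ε₃^⊠2) = bR(det₃) = 17; e.g. from bR(ε₃^⊠3) ≤ 63 or R(ε₃^⊠N) < 4^N
for one N (ε₃ inlined exactly as the factors of Det3Flat). [deps: Det3Flat] [difficulty: L] (why it
might fail: border rank of ε₃-powers may be multiplicative from the square on (bR(ε₃^⊠2k) = 17^k, as
cubes are for cw_q, q > 4, CGLV Thm 1.2), freezing R~(ε₃) at √17 > 4; the next power lives in format
27 at rank ≈ 63, beyond current certified searches.) [ConnerGesmundoLandsbergVentura2022,
ConnerHuangLandsberg2020, ConnerHarperLandsberg2019, arXiv:2601.08119]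
#5 JTwoSquareStrict (crux) — the cheapest new datum of the line: strict submultiplicativity of
BORDER rank at the Kronecker square of J_2, bR(J_2^⊠2) ≤ 63 < 64 = bR(J_2)² (algebraic border rank
over ℂ[ε], format 25×25×25), the J_2-analogue of bR(det₃) = 17 < 25; NA-ARC needs bR(J_2^⊠N)^(1/N) →
5. [difficulty: M] (why it might fail: squares can be border-rank multiplicative — bR(cw₂^⊠2) = 16 =
4² (ConnerHuangLandsberg2020 Thm 1.1) — and Koszul flattenings cannot decide it (they certify at
most ≈ 48 < 64 in this format), so only an explicit ε-decomposition settles the positive side.)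
[ConnerHuangLandsberg2020, ConnerGesmundoLandsbergVentura2022, arXiv:1909.04785, arXiv:2009.11391]
#6 NAARCCounterexample (crux) — NEGATIVE SIDE (¬NA-ARC in general form, filed so refuters can attack
the principle directly; card item C3): there is a concise tensor T ∈ ℂ^d₁⊗ℂ^d₂⊗ℂ^d₃ whose stabiliser
Lie algebra g_T (all (X,Y,Z) with (X⊗1⊗1 + 1⊗Y⊗1 + 1⊗1⊗Z)·T = 0) acts irreducibly on each leg (⇔
G_T⁰ irreducible, char 0) and R~(T) > max dᵢ. Candidates: J_l (l ≥ 2), the G₂ 3-form, structure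
tensors of simple Lie algebras, Cartan's E₆ cubic, Clebsch–Gordan tensors T_(a,b,c) in the interior
of the triangle. [difficulty: open-problem] (why it might fail: no spectral point exceeding the
maximal flattening rank is known for ANY tensor (all quantum functionals are ≤ max dᵢ, and = max dᵢ
on this class), so a proof needs a genuinely new universal spectral point or an SCC-type conditional
transfer; NA-ARC may simply be true.) [ChristandlVranaZuiddam2023,
ConnerGesmundoLandsbergVenturaWang2020, arXiv:2311.02774, arXiv:2310.11926, Strassen1988]
#9 LadderLowerFrame (support) — lower frame making '= 2l+1' meaningful: for all l ≥ 1, 2l+1 ≤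
R~(J_l) (J_l is concise — its flattening V_2l → V_2l⊗V_2l is a non-zero SL₂-equivariant map from an
irreducible module, or check the explicit minors — and flattening rank is multiplicative under
Kronecker powers and bounds rank below: flatteningRank_kroneckerPow, flatteningRank_le_tensorRank,
in tree). [difficulty: provable-now] [ConnerGesmundoLandsbergVenturaWang2020,
BurgisserClausenShokrollahi1997]
#9 PrattWitnessToral (support) — the SCC filter, Pratt side (card item S0, all k): for every k ≥ 1
the stabiliser Lie algebra of Pratt's balanced tripartition tensor T_k = Σ over ordered partitions
of [3k] into k-sets of e_A⊗e_B⊗e_C consists of DIAGONAL triples only (it is the tightness torus +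
scalars), so G⁰ acts reducibly on ℂ^C(3k,k) and T_k lies outside the NA-ARC class; verified for k =
1, 2 by exact rational linear algebra this session (dim g = 4, 7). [difficulty: M]
[arXiv:2311.02774, ConnerGesmundoLandsbergVenturaWang2020]
#9 BKWitnessSolvable (support) — the SCC filter, Björklund–Kaski side (card item S0): for the 7×7×7
tensor Q (legs = proper subsets of [3]; Q(X,Y,Z) = 1 iff X ⊔ Y ⊔ Z = [3]) every element of g_Q is
'cardinality-non-increasing' — its (a,a') entries vanish unless a = a' or |a| < |a'| — so G_Q⁰
preserves the flag by cardinality, fixes the line ℂ·e_∅ on each leg and acts reducibly (computed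
this session: dim g_Q = 8 = 3 torus + 2 scalars + 3 nilpotent singleton←pair operators).
[difficulty: provable-now] [arXiv:2310.11926, ConnerGesmundoLandsbergVenturaWang2020]

TWO-LAYER PLAN. Foreseen glued splits (nothing filed now): ThreeJTwoFlat ⇐ JTwoPowerDecay →
BorderToAsymptotic → ThreeJTwoFlat, with JTwoPowerDecay =
'∀ ε > 0 ∃ N ≥ 1, bR(J_2^⊠N) ≤ (5+ε)^N' (the constructive content; JTwoSquareStrict is its N = 2
sign of life) and BorderToAsymptotic =
'R~(t) ≤ bR(t^⊠N)^(1/N)' (in tree up to bookkeeping: asymptoticRank_le_of_algBorderRank_le,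
approxRank_kroneckerPow_le); Det3Flat ⇐
LeviCivitaBelowFour → (R~(ε₃) ≤ 3, e.g. by Borel-fixed apolar witnesses for ε₃^⊠N of Hilbert
function 3^(N(1+o(1)))) → Det3Flat;
NAARCLadder ⇐ X_MaMu (= route AsymptoticSpectrum's AThesis up to the proved identity R~(⟨2,2,2⟩) =
2^ω; shared, not re-filed) → X_J → NAARCLadder;
NAARCCounterexample ⇐ (SCC-transfer: an efficient degeneration of J-powers or MaMu-powers onto Q^⊠m
/ T_k^⊠m) → (SCC as hypothesis) → ¬X, once an SCC named fact exists in Literature.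

KILL CRITERIA. A certified R~(J_l) > 2l+1 for any l, or NAARCCounterexample proved, refutes
NAARCLadder: close `refuted:NAARCLadder` (card refuted;
ω untouched — the census records that continuous irreducible symmetry does not force flatness). ω(ℂ)
> 2 (routes BorderRankLowerBound,
NilCoxeterShadow) refutes X_MaMu, Det3Flat and every positive route at once. A proof that Q or some
T_k (k large) is an efficient
degeneration of Kronecker powers of J_l / ⟨n,n,n⟩ at the ARC rate makes NA-ARC exactly as
SCC-doubtful as ARC: pivot the thesis to the
sub-class surviving the transfer or close `superseded`. JTwoSquareStrict refuted alone (bR(J_2^⊠2) =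
64) is NOT a kill — pivot the data
programme to the cube and to ε₃^⊠3 (LeviCivitaBelowFour); both squares AND cubes multiplicative for
J_2 and ε₃ ⇒ close `exhausted` with census.
ω = 2 proved elsewhere moots the assembly but not X_J (then hand X_J to Literature as a conjecture
card).

NOT DECOMPOSED YET. The ENGINE (card C2): border apolarity for T^⊠N with the growing Borel B_T^N ⋊
S_N and the Fixed Ideal Theorem (BuczynskaBuczynski2021;
ConnerHarperLandsberg2019 give the N = 2 census for det₃) — no multigraded-Hilbert-scheme / Slip API
in Lean, and as a statement it is
NA-ARC restated, so it rides as the mechanism behind ThreeJTwoFlat / Det3Flat, not as an item. The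
POSITIVE general NA-ARC (∀ T in the
class) — only its negation is filed; the positive form waits for a stabiliser/irreducibility API and
for the ladder to show life. The
2-parameter Clebsch–Gordan family T_(a,b,c) = coefficient tensor of [12]^p[23]^q[31]^r (boundary c =
a+b is polynomial multiplication,
flat even for RANK; interior interpolates to J_l) — later children of X_J. Structure tensors of
simple Lie algebras and Cartan's E₆ cubic
as further rungs. Any laser-method VALUE of J_2 (whether R~(J_2) = 5 says anything about ω) —
deliberately not claimed. Numerics of
R(J_2), R(J_2^⊠2), bR(ε₃^⊠3) — kit jobs to be requested by whoever takes ranks 4–5.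

CHEAPEST FALSIFIER. Already run this session (exact rational linear algebra, folder calc/stab.py):
the card's own fastest refutation S0 — does an SCC-hard
witness satisfy the NA-ARC hypothesis? NO: g_(T_2) is toral (dim 7, all diagonal), g_Q is solvable
(dim 8; three nilpotent
singleton←pair operators, flag by cardinality preserved), g_(T_1 = cw₂') toral — the filter holds at
k ≤ 2. Next cheapest: (i) a
literature/computer check whether Q ∈ closure(GL₇³·J_3) or T_k ⊴ J- /MaMu-powers at ARC rate (would
price NA-ARC by SCC); (ii) a numerical
border-rank search for J_2^⊠2 at r = 63 (25×25×25; a hit PROVES JTwoSquareStrict, persistent failure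
at r ≤ 63 with success at 64 is the
first negative datum); (iii) look up whether R~ or bR of the G₂ 3-form / of the quartic J-invariant
cubic is already in print.

NUMBERS. bR(ε₃) = 5 (ConnerGesmundoLandsbergVentura2022 Prop 3.1; PROVED in tree,
CGLV2022_prop31_holds); bR(det₃) = bR(ε₃^⊠2) = 17 (≤ 17 PROVED in
tree from the Conner–Huang–Landsberg expression, BorderRankCWDet3Seventeen; ≥ 17
ConnerHarperLandsberg2019, not vendored) ⇒ 3 ≤ R~(ε₃) ≤ √17
≈ 4.1231, 9 ≤ R~(det₃) ≤ 17. J_2: concise; Koszul flattening (p = 2) rank 45 ⇒ bR(J_2) ≥ ⌈45/6⌉ = 8;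
every quinary cubic has border
Waring rank ≤ 8 (Alexander–Hirschowitz: σ₇(ν₃(ℙ⁴)) defective, σ₈ fills) ⇒ bR(J_2) = 8; 5 ≤ R~(J_2) ≤
8; bR(J_2)² = 64. J_3 (G₂ 3-form):
Koszul (p = 3) full rank 245 ⇒ bR(J_3) ≥ 13; NA-ARC predicts 7. Stabiliser algebras (incl. 2 scalar
dims): J_1 10, J_2 5, J_3 16, J_4 5;
Q 8 (non-toral, solvable), T_2 7 (toral), T_1 4 (toral). R~(⟨2,2,2⟩) = 2^ω ∈ [4, 2^2.371339 ≈ 5.17).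
SCC ⇒ R~(T_k) > (8−ε)^k for large k
(arXiv:2311.02774 Thm 1.x/Cor), against dim C(3k,k) = 6.75^(k+o(k)); ARC at the single tensor Q ⇒
¬SCC (arXiv:2310.11926). Items at open:
10 (1 target, 5 cruxes, 3 support, 1 assembly).

DEFINITION REQUESTS. `threeJTensor (l : ℕ) : Fin (2l+1) → Fin (2l+1) → Fin (2l+1) → ℂ` (the inlined
J, under Summits/MatrixMultiplication/MatrixMultiplication/Theorems)
so that the four J-items can be restated without the `let`; later a `stabiliserAlgebra` /
leg-irreducibility predicate for the positive
general NA-ARC. Cite facts wanted: ConnerHarperLandsberg2019 (bR(det₃) ≥ 17), CGLV2022 Prop 2.2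
(R~(T_skewcw,q) = q+1 ⇒ ω = 2; also wanted by
route AsymptoticRankCW's GlueDet3Omega), Björklund–Kaski / Pratt SCC statements as named facts (for
the conditional negative branch).

Novelty: Searches (2026-08-15): `lit frontier MatrixMultiplication --since 2022` (30 rows; read
arXiv:2601.08119 'Asymptotic rank bounds: a
numerical census' — format-generic Kaski–Michałek bounds, no symmetric instances; arXiv:2601.21553
support = quantum functionals);
`lit read` of ConnerGesmundoLandsbergVenturaWang2020 (held: §1 remark 'dimension of the symmetry
group is upper semicontinuous …
evidence to favor Conjecture 1.3', §2.1 tightness = regular semisimple element in g_T, §4 Thm 4.1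
propagation of symmetries, Problem
4.2), of arXiv:2310.11926 (Q, §3.1; p.10 'P^⊗n lacks the transitive automorphisms of MaMu') and
arXiv:2311.02774 (T_k tight and
concise, Thm 1.9, SCC ⇒ R~(T_k) > (8−ε)^k); `lit galaxy search "asymptotic rank conjecture" --star
all` (2 hits: LandsbergMichalek2019Haystack,
CGLVW); `lit galaxy search "3j-symbol" --star pdf` (10, all physics/rep-theory, none on tensor
rank); `lit vsearch` on 'stabilizer acts
irreducibly on each factor, asymptotic rank' (8 book hits, none relevant); `lit search --source
zbmath "3j symbol tensor rank
Clebsch-Gordan asymptotic rank"` (0); S2 / OpenAlex / arXiv APIs rate-limited (HTTP 429) this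
session, local searchd reset once — recorded
in NOTES.md; the card's refuter audit (CGLV arXiv:1909.04785 Thm 6.3, CGL arXiv:1909.09518 'tensors
with maximal symmetries') re-read.
Nearest prior art found: ConnerGesmundoLandsbergVenturaWang2020 (arXiv:1811.05511) — symmetry-group
dimension as the geometric invariant
behind tight-ARC, propagation o  [refs: 2601.08119, 2601.21553, 2310.11926, 2311.02774, 1909.04785, 1909.09518, 1811.05511, ConnerGesmundoLandsbergVenturaWang2020, Strassen1991, ConnerGesmundoLandsbergVentura2022]

Barriers (technique_class: asymptotic-rank-conjecture, stabiliser-symmetry): - technique_class: asymptotic-rank-conjecture, stabiliser-symmetry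
- Literature.Barriers.MatrixMultiplication.UnstableTensorBarrier: evaded by construction —
irreducible G⁰ ⇒ scalar marginals ⇒ critical, hence semistable (Kempf–Ness); the class is disjoint
from the barrier's unstable tensors, and no ω-bound is extracted from J_l anyway.
- Literature.Barriers.MatrixMultiplication.IrreversibilityBarrier: not in the class — X_MaMu is
R~(⟨n,n,n⟩) itself (i = 1 tautologically) and the J_l are never used as intermediate tensors for ω;
only Det3Flat's payoff (CGLV Prop 2.2) is a laser step, at the tensor T_skewcw,2 which the catalogue
lists as unobstructed at q = 2.
- Literature.Barriers.MatrixMultiplication.UniversalMethodBarrier: n/a — no CW_q, no fixed starting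
tensor degenerated into matrix products.
- Literature.Barriers.MatrixMultiplication.InfimumNotMinimumBarrier: respected — every item is an
asymptotic-rank / power statement, none asserts an exact finite algorithm attaining an exponent.
- Literature.Barriers.MatrixMultiplication.LinearRankMethodBarrier: bites only on the negative crux
— R~(T) > max dᵢ cannot come from flattenings/Koszul (they are ≤ max dᵢ asymptotically and
cactus-bounded); the lower-bound numbers quoted (bR(J_2) = 8, bR(J_3) ≥ 13) are used as data, not as
certificates toward X.
- Negatives index: empty at filing (`ledger negatives --problem MatrixMultiplication`: 0 refuted
statements, 2026-08-15).

Novelty grade: variant — ROUTE REVIEW+novelty (refuter 2026-08-15). variant = Strassen's asymptotic rank conjecture for TIGHT tensors (Strassen1991; BCS Probl.15.5; CGLVW2020 Conj.1.3, whose Sec.1 already cites symmetry-group dimension as evidence, Sec.4 propagation of symmetries) restricted to connected-irreducible stabili (refuter refuter-rreview-route-MatrixMultiplicati-88df8b29-0, 2026-08-15T13:43:39Z; prior: Strassen1991,arXiv:1811.05511,arXiv:1909.04785,ConnerHarperLandsberg2019,arXiv:2310.11926,arXiv:2311.02774,Olver1999,route-MatrixMultiplication-AsymptoticRankCW)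

History (route lifecycle, newest last):
- 2026-08-16T04:11:05Z · AUTO-CRUX (backfill): NAARCLadder — hypotheses of the deciding theorem that nothing in the route derives are cruxes (operator:999:1085951)
- 2026-08-23T11:29:36Z · DORMANT — reconciler: no traction for 6.1 d (last activity statement-grounded at 2026-08-17T08:42:09Z); parked, not closed — `ledger route dormant route-MatrixMultiplicat (operator:999:4445)

sub-problem: MatrixMultiplication · status: dormant · opened planner-plancard-MatrixMultiplication-MatrixM-f9deb16b-0 2026-08-15T11:38:41Z · rev 2 · ledger route-MatrixMultiplication-NonabelianARC
GENERATED by the gate from the ledger (D-0016/17). Provers cite these decls: `theorem foo : Summit.MatrixMultiplication.MatrixMultiplication.Theses.NonabelianARC.<Decl> := …` in Summits/MatrixMultiplication/MatrixMultiplication/Theorems/<Name>.lean.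
-/

namespace Summit.MatrixMultiplication.MatrixMultiplication.Theses.NonabelianARC

open scoped BigOperators Topology Manifold Classical MeasureTheory ProbabilityTheory Matrix InnerProductSpace ComplexConjugate ContinuousMap
open Filter Set Function TopologicalSpace MeasureTheory

attribute [summit_statement] _root_.MatrixMultiplication

/-- item stmt-MatrixMultiplication-4972 · crux (kind.auto-crux: conjecture-grade) · rank 0 · open · by planner
why it might fail: a dark (non-quantum) spectral point may ignore symmetry; or NA-ARC may inherit SCC-inconsistency through an efficient degeneration of J- /MaMu-powers onto Q or T_k; X_J is far stronger than ω = 2 (bR(J_3) ≥ 13 vs 7).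
sources: ConnerGesmundoLandsbergVenturaWang2020, arXiv:2310.11926, arXiv:2311.02774, ChristandlVranaZuiddam2023, Strassen1991
[target] X = X_MaMu ∧ X_J as in § Thesis: R~(⟨n,n,n⟩) = n² for all n ≥ 1 and R~(J_l) = 2l+1 for all
l ≥ 1 (J_l inlined by the closed formula; card items C1 + the MaMu instance). -/
@[route_item "route-MatrixMultiplication-NonabelianARC", crux]
def NAARCLadder : Prop :=
  let J : (l : ℕ) → Fin (2 * l + 1) → Fin (2 * l + 1) → Fin (2 * l + 1) → ℂ := fun l a b c => if a.val + b.val + c.val = 3 * l then ∑ t ∈ Finset.range (l + 1), (if l ≤ t + b.val ∧ a.val ≤ t + l then (-1 : ℂ) ^ (t + a.val + b.val) * ((Nat.choose l t * Nat.choose l (t + b.val - l) * Nat.choose l (t + l - a.val) : ℕ) : ℂ) else 0) else 0; (∀ n : ℕ, 1 ≤ n → Literature.Computability.AlgebraicComplexity.asymptoticRank (Literature.Computability.AlgebraicComplexity.matMulTensor ℂ n n n) = (n : ℝ) ^ 2) ∧ (∀ l : ℕ, 1 ≤ l → Literature.Computability.AlgebraicComplexity.asymptoticRank (J l) = 2 *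 (l : ℝ) + 1)

/-- item stmt-MatrixMultiplication-4973 · crux · rank 2 · open · by planner
why it might fail: any value in (5, 8] is consistent with all known bounds; no exact 'R~ = flattening rank < bR' theorem exists for ANY tensor; upper-bound tools are only border ranks of small powers and Alman–Li speed-ups; a spectral point > 5 at J_2 kills it and NA-ARC.
sources: ConnerGesmundoLandsbergVenturaWang2020, ConnerGesmundoLandsbergVentura2022, AlmanLi2026, ChristandlVranaZuiddam2023, arXiv:2601.21553
[crux] the first ω-independent NA-ARC instance: R~(J_2) = 5 for the 5×5×5 tensor J_2 (polarised
cubic J-invariant of binary quartics = det of the traceless symmetric 3×3 matrix = ⟨3,3,3⟩|Sym²₀;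
card item C1). Known 5 ≤ R~(J_2) ≤ bR(J_2) = 8; tight with uniform marginals, so Q~(J_2) = 5 = every
F^θ(J_2). [difficulty: open-problem] -/
@[route_item "route-MatrixMultiplication-NonabelianARC"]
def ThreeJTwoFlat : Prop :=
  let J : (l : ℕ) → Fin (2 * l + 1) → Fin (2 * l + 1) → Fin (2 * l + 1) → ℂ := fun l a b c => if a.val + b.val + c.val = 3 * l then ∑ t ∈ Finset.range (l + 1), (if l ≤ t + b.val ∧ a.val ≤ t + l then (-1 : ℂ) ^ (t + a.val + b.val) * ((Nat.choose l t * Nat.choose l (t + b.val - l) * Nat.choose l (t + l - a.val) : ℕ) : ℂ) else 0) else 0; Literature.Computability.AlgebraicComplexity.asymptoticRank (J 2) = 5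

/-- item stmt-MatrixMultiplication-0591 · crux · rank 3 · open · by planner
why it might fail: only 9 ≤ R~(det₃) ≤ bR(det₃) = 17 is known (ConnerHarperLandsberg2019, ConnerHuangLandsberg2020); '= 9' forces ω = 2, so ω > 2 or any spectral point > 3 at ε₃ refutes it; border rank may be multiplicative from the square on.
sources: ConnerGesmundoLandsbergVentura2022, ConnerHarperLandsberg2019, ConnerHuangLandsberg2020, arXiv:1909.04785
Skew sibling (arXiv:1909.04785 Prop 2.2 and §1): the asymptotic rank of the 3×3 determinant tensor
det_3 ∈ ℂ^9⊗ℂ^9⊗ℂ^9 (entry sgn-product ε_{a1 b1 c1} ε_{a2 b2 c2} at ((a1,a2),(b1,b2),(c1,c2)))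
equals its flattening rank 9; since det_3 = T_skewcw,2^{⊠2} up to change of basis and the CW90 bound
holds for T_skewcw,q, R~(det_3) = 9 ⇒ R~(T_skewcw,2) = 3 ⇒ ω = 2. Needs
kroneckerTensor/asymptoticRank definitions; det_3 tensor can be inlined via Equiv.Perm.sign once
wanted. -/
@[route_item "route-MatrixMultiplication-NonabelianARC"]
def Det3Flat : Prop :=
  Literature.Computability.AlgebraicComplexity.asymptoticRank (Literature.Computability.AlgebraicComplexity.kroneckerTensor (fun a b c : Fin 3 => (if b = a + 1 ∧ c = a + 2 then (1 : ℂ) else 0) - (if b = a + 2 ∧ c = a + 1 then 1 else 0)) (fun a b c : Fin 3 => (if b = a + 1 ∧ c = a + 2 then (1 : ℂ) else 0) - (if b = a + 2 ∧ c = a + 1 then 1 else 0))) = 9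

/-- item stmt-MatrixMultiplication-4974 · crux · rank 4 · open · by planner
why it might fail: border rank of ε₃-powers may be multiplicative from the square on (bR(ε₃^⊠2k) = 17^k, as cubes are for cw_q, q > 4, CGLV Thm 1.2), freezing R~(ε₃) at √17 > 4; the next power lives in format 27 at rank ≈ 63, beyond current certified searches.
sources: ConnerGesmundoLandsbergVentura2022, ConnerHuangLandsberg2020, ConnerHarperLandsberg2019, arXiv:2601.08119
[crux] sign of life on the shared rung: R~(ε₃) < 4, i.e. strictly below the record √17 ≈ 4.123 given
by bR(ε₃^⊠2) = bR(det₃) = 17; e.g. from bR(ε₃^⊠3) ≤ 63 or R(ε₃^⊠N) < 4^N for one N (ε₃ inlined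
exactly as the factors of Det3Flat). [deps: Det3Flat] [difficulty: L] -/
@[route_item "route-MatrixMultiplication-NonabelianARC"]
def LeviCivitaBelowFour : Prop :=
  Literature.Computability.AlgebraicComplexity.asymptoticRank (fun a b c : Fin 3 => (if b = a + 1 ∧ c = a + 2 then (1 : ℂ) else 0) - (if b = a + 2 ∧ c = a + 1 then 1 else 0)) < 4

/-- item stmt-MatrixMultiplication-4975 · crux · rank 5 · open · by planner
why it might fail: squares can be border-rank multiplicative — bR(cw₂^⊠2) = 16 = 4² (ConnerHuangLandsberg2020 Thm 1.1) — and Koszul flattenings cannot decide it (they certify at most ≈ 48 < 64 in this format), so only an explicit ε-decomposition settles the positive side.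
sources: ConnerHuangLandsberg2020, ConnerGesmundoLandsbergVentura2022, arXiv:1909.04785, arXiv:2009.11391
[crux] the cheapest new datum of the line: strict submultiplicativity of BORDER rank at the
Kronecker square of J_2, bR(J_2^⊠2) ≤ 63 < 64 = bR(J_2)² (algebraic border rank over ℂ[ε], format
25×25×25), the J_2-analogue of bR(det₃) = 17 < 25; NA-ARC needs bR(J_2^⊠N)^(1/N) → 5. [difficulty:
M] -/
@[route_item "route-MatrixMultiplication-NonabelianARC"]
def JTwoSquareStrict : Prop :=
  let J : (l : ℕ) → Fin (2 * l + 1) → Fin (2 * l + 1) → Fin (2 * l + 1) → ℂ := fun l a b c => if a.val + b.val + c.val = 3 * l then ∑ t ∈ Finset.range (l + 1), (if l ≤ t + b.val ∧ a.val ≤ t + l then (-1 : ℂ) ^ (t + a.val + b.val) * ((Nat.choose l t * Nat.choose l (t + b.val - l) * Nat.choose l (t + l - a.val) : ℕ) : ℂ) else 0) else 0; Literature.Computability.AlgebraicComplexity.algBorderRank (Literature.Computability.AlgebraicComplexity.kroneckerPow (J 2) 2) < 64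

/-- item stmt-MatrixMultiplication-4976 · crux · rank 6 · open · by planner
why it might fail: no spectral point exceeding the maximal flattening rank is known for ANY tensor (all quantum functionals are ≤ max dᵢ, and = max dᵢ on this class), so a proof needs a genuinely new universal spectral point or an SCC-type conditional transfer; NA-ARC may simply be true.
sources: ChristandlVranaZuiddam2023, ConnerGesmundoLandsbergVenturaWang2020, arXiv:2311.02774, arXiv:2310.11926, Strassen1988
[crux] NEGATIVE SIDE (¬NA-ARC in general form, filed so refuters can attack the principle directly;
card item C3): there is a concise tensor T ∈ ℂ^d₁⊗ℂ^d₂⊗ℂ^d₃ whose stabiliser Lie algebra g_T (all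
(X,Y,Z) with (X⊗1⊗1 + 1⊗Y⊗1 + 1⊗1⊗Z)·T = 0) acts irreducibly on each leg (⇔ G_T⁰ irreducible, char
0) and R~(T) > max dᵢ. Candidates: J_l (l ≥ 2), the G₂ 3-form, structure tensors of simple Lie
algebras, Cartan's E₆ cubic, Clebsch–Gordan tensors T_(a,b,c) in the interior of the triangle.
[difficulty: open-problem] -/
@[route_item "route-MatrixMultiplication-NonabelianARC"]
def NAARCCounterexample : Prop :=
  ∃ (d₁ d₂ d₃ : ℕ) (T : Fin d₁ → Fin d₂ → Fin d₃ → ℂ), let S : Matrix (Fin d₁) (Fin d₁) ℂ → Matrix (Fin d₂) (Fin d₂) ℂ → Matrix (Fin d₃) (Fin d₃) ℂ → Prop := fun X Y Z => ∀ a b c, (∑ a', X a a' * T a' b c) + (∑ b', Y b b' * T a b' c) + (∑ c', Z c c' * T a b c') = 0; LinearIndependent ℂ (fun a : Fin d₁ => fun p : Fin d₂ × Fin d₃ => T a p.1 p.2) ∧ LinearIndependent ℂ (fun b : Fin d₂ => fun p : Fin d₁ × Fin d₃ => T p.1 b p.2) ∧ LinearIndependent ℂ (fun c : Fin d₃ =>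 fun p : Fin d₁ × Fin d₂ => T p.1 p.2 c) ∧ (∀ W : Submodule ℂ (Fin d₁ → ℂ), (∀ X Y Z, S X Y Z → ∀ w ∈ W, X.mulVec w ∈ W) → W = ⊥ ∨ W = ⊤) ∧ (∀ W : Submodule ℂ (Fin d₂ → ℂ), (∀ X Y Z, S X Y Z → ∀ w ∈ W, Y.mulVec w ∈ W) → W = ⊥ ∨ W = ⊤) ∧ (∀ W : Submodule ℂ (Fin d₃ → ℂ), (∀ X Y Z, S X Y Z → ∀ w ∈ W, Z.mulVec w ∈ W) → W = ⊥ ∨ W = ⊤) ∧ ((max d₁ (max d₂ d₃) : ℕ) : ℝ) < Literature.Computability.AlgebraicComplexity.asymptoticRank T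

/-- item stmt-MatrixMultiplication-17870 · crux · rank 7 · open · by planner
why it might fail: Each rung is a separate tight-ARC instance with border rank far above flattening rank (bR(J_2) = 8 vs 5, bR(J_3) ≥ 13 vs 7); one universal spectral point > max dim on some J_l, or SCC-transfer via a degeneration onto the Pratt/BK witnesses, kills it; no uniform-in-l mechanism is known.
sources: ConnerGesmundoLandsbergVenturaWang2020, ChristandlVranaZuiddam2023, arXiv:2310.11926, arXiv:2311.02774, Olver1999
[crux] the ω-INDEPENDENT rungs of the ladder: for all l ≥ 2, R~(J_l) = 2l+1, J_l the SL₂-invariant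
3j tensor in (ℂ^{2l+1})^⊗3 inlined by the route's closed formula (= threeJTensor l by rfl); l = 2 is
crux ThreeJTwoFlat (5×5×5, bR(J_2) = 8), l = 3 the G₂ 3-form (bR ≥ 13). The falsifiable content of
NA-ARC with no bearing on ω (used toward NAARCLadder, not toward the Statement); lower frame =
LadderLowerFrame. Plan: border-rank power decay per rung (first datum JTwoSquareStrict, bR(J_2^⊠2) ≤
63) + the proved transfer R~(t)^N ≤ R~(t^⊠N) ≤ bR(t^⊠N); skeleton
Cruxes/NAARCLadder/Lines/jladder_birth.lean (stub_lowerFrame, stub_borderPowerDecay). -/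
@[route_item "route-MatrixMultiplication-NonabelianARC"]
def JLadderHigherFlat : Prop :=
  let J : (l : ℕ) → Fin (2 * l + 1) → Fin (2 * l + 1) → Fin (2 * l + 1) → ℂ := fun l a b c => if a.val + b.val + c.val = 3 * l then ∑ t ∈ Finset.range (l + 1), (if l ≤ t + b.val ∧ a.val ≤ t + l then (-1 : ℂ) ^ (t + a.val + b.val) * ((Nat.choose l t * Nat.choose l (t + b.val - l) * Nat.choose l (t + l - a.val) : ℕ) : ℂ) else 0) else 0; ∀ l : ℕ, 2 ≤ l → Literature.Computability.AlgebraicComplexity.asymptoticRank (J l) = 2 * (l : ℝ) + 1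

/-- item stmt-MatrixMultiplication-17871 · support · rank 9 · open · by planner
sources: ConnerGesmundoLandsbergVentura2022, ChristandlVranaZuiddam2023, AlmanDuanVassilevskaWilliamsXuXuZhou2025
[support] SPLIT GLUE (BC2 redirect, crux-strategist 2026-08-17): Det3Flat → JLadderHigherFlat →
NAARCLadder — makes the restated deciding crux NAARCLadder (= X_MaMu ∧ X_J, X_MaMu ⟺ ω = 2) the
DERIVED node of two pieces: the route's own rank-3 crux Det3Flat (stmt-0591, R~(ε₃ ⊠ ε₃) = 9, the l
= 1 rung in det₃ form, shared with AsymptoticRankCW) and the new crux JLadderHigherFlat (the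
ω-independent rungs l ≥ 2). PROVED sorry-free already: theorem NAARCLadder_of_subs in
Cruxes/NAARCLadder/Lines/rungs_split.lean (also attached as evidence Split.lean on stmt-4972; lean
check rc 0, 0 warnings, axioms propext/Classical.choice/Quot.sound, ~190 lines) — Theorems/ is
prover-only, so a prover lands that file verbatim as Theorems/NonabelianARCNAARCLadderSplit.lean and
closes this item by `theorem … : NonabelianARC.NAARCLadderOfRungs := fun h₁ h₂ =>
NAARCLadder_of_subs h₁ h₂` (the pieces unfold to the inlined hypotheses verbatim). Proof content
(the seam is NOT And.intro): (1) ω(ℂ) = 2 from Det3Flat by the landed glue of AsymptoticRankCW,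
glueDet3Omega_proof : BDet3AsymptoticRank → MatrixMultiplication (skew Coppersmith–Winograd laser
bound, ConnerGesmundoLandsbergVentura2022 §2.3: 'R~(det₃) = 9 -/
@[route_item "route-MatrixMultiplication-NonabelianARC"]
def NAARCLadderOfRungs : Prop :=
  Det3Flat → JLadderHigherFlat → NAARCLadder

/-- item stmt-MatrixMultiplication-4977 · support · rank 9 · open · by planner
sources: ConnerGesmundoLandsbergVenturaWang2020, BurgisserClausenShokrollahi1997
[support] lower frame making '= 2l+1' meaningful: for all l ≥ 1, 2l+1 ≤ R~(J_l) (J_l is concise —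
its flattening V_2l → V_2l⊗V_2l is a non-zero SL₂-equivariant map from an irreducible module, or
check the explicit minors — and flattening rank is multiplicative under Kronecker powers and bounds
rank below: flatteningRank_kroneckerPow, flatteningRank_le_tensorRank, in tree). [difficulty:
provable-now] -/
@[route_item "route-MatrixMultiplication-NonabelianARC"]
def LadderLowerFrame : Prop :=
  let J : (l : ℕ) → Fin (2 * l + 1) → Fin (2 * l + 1) → Fin (2 * l + 1) → ℂ := fun l a b c => if a.val + b.val + c.val = 3 * l then ∑ t ∈ Finset.range (l + 1), (if l ≤ t + b.val ∧ a.val ≤ t + l then (-1 : ℂ) ^ (t + a.val + b.val) * ((Nat.choose l t * Nat.choose l (t + b.val - l) * Nat.choose l (t + l - a.val) : ℕ) : ℂ) else 0) else 0; ∀ l : ℕ, 1 ≤ l → 2 * (l : ℝ) + 1 ≤ Literature.Computability.AlgebraicComplexity.asymptoticRank (J l)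

/-- item stmt-MatrixMultiplication-4978 · support · rank 9 · open · by planner
sources: arXiv:2311.02774, ConnerGesmundoLandsbergVenturaWang2020
[support] the SCC filter, Pratt side (card item S0, all k): for every k ≥ 1 the stabiliser Lie
algebra of Pratt's balanced tripartition tensor T_k = Σ over ordered partitions of [3k] into k-sets
of e_A⊗e_B⊗e_C consists of DIAGONAL triples only (it is the tightness torus + scalars), so G⁰ acts
reducibly on ℂ^C(3k,k) and T_k lies outside the NA-ARC class; verified for k = 1, 2 by exact
rational linear algebra this session (dim g = 4, 7). [difficulty: M] -/
@[route_item "route-MatrixMultiplication-NonabelianARC"]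
def PrattWitnessToral : Prop :=
  ∀ k : ℕ, 1 ≤ k → let T : {A : Finset (Fin (3 * k)) // A.card = k} → {A : Finset (Fin (3 * k)) // A.card = k} → {A : Finset (Fin (3 * k)) // A.card = k} → ℂ := fun a b c => if Disjoint a.1 b.1 ∧ Disjoint a.1 c.1 ∧ Disjoint b.1 c.1 then 1 else 0; ∀ X Y Z : Matrix {A : Finset (Fin (3 * k)) // A.card = k} {A : Finset (Fin (3 * k)) // A.card = k} ℂ, (∀ a b c, (∑ a', X a a' * T a' b c) + (∑ b', Y b b' * T a b' c) + (∑ c', Z c c' * T a b c') = 0) → ∀ a a', a ≠ a' → X a a' = 0 ∧ Y a a' = 0 ∧ Z a a' = 0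

/-- item stmt-MatrixMultiplication-4979 · support · rank 9 · open · by planner
sources: arXiv:2310.11926, ConnerGesmundoLandsbergVenturaWang2020
[support] the SCC filter, Björklund–Kaski side (card item S0): for the 7×7×7 tensor Q (legs = proper
subsets of [3]; Q(X,Y,Z) = 1 iff X ⊔ Y ⊔ Z = [3]) every element of g_Q is
'cardinality-non-increasing' — its (a,a') entries vanish unless a = a' or |a| < |a'| — so G_Q⁰
preserves the flag by cardinality, fixes the line ℂ·e_∅ on each leg and acts reducibly (computed
this session: dim g_Q = 8 = 3 torus + 2 scalars + 3 nilpotent singleton←pair operators).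
[difficulty: provable-now] -/
@[route_item "route-MatrixMultiplication-NonabelianARC"]
def BKWitnessSolvable : Prop :=
  let T : {A : Finset (Fin 3) // A ≠ Finset.univ} → {A : Finset (Fin 3) // A ≠ Finset.univ} → {A : Finset (Fin 3) // A ≠ Finset.univ} → ℂ := fun a b c => if Disjoint a.1 b.1 ∧ Disjoint a.1 c.1 ∧ Disjoint b.1 c.1 ∧ a.1 ∪ b.1 ∪ c.1 = Finset.univ then 1 else 0; ∀ X Y Z : Matrix {A : Finset (Fin 3) // A ≠ Finset.univ} {A : Finset (Fin 3) // A ≠ Finset.univ} ℂ, (∀ a b c, (∑ a', X a a' * T a' b c) + (∑ b', Y b b' * T a b' c) + (∑ c', Z c c' * T a b c') = 0) → ∀ a a', a ≠ a' → a'.1.card ≤ a.1.card → X a a' = 0 ∧ Y a a' = 0 ∧ Z a a' = 0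

/-- item stmt-MatrixMultiplication-4980 · assembly · rank 1 · open · by planner
sources: AlmanDuanVassilevskaWilliamsXuXuZhou2025, Blaser2013, Strassen1988
[assembly] NAARCLadder → MatrixMultiplication (ω(ℂ) = 2), via R~(⟨2,2,2⟩) = 2^ω. -/
@[route_item "route-MatrixMultiplication-NonabelianARC"]
def Assembly : Prop :=
  NAARCLadder → MatrixMultiplication

/-! D-0027 §2.1 — DECIDING THEOREM (planner-authored via `route open/edit --closes-file`; by planner-rbadge-MatrixMultiplication-Nonabelian-6be3b3a0-g2-0 2026-08-15T16:13:37Z):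
its hypotheses are this route's items and its conclusion the sub-problem Statement (glue_lint), and it elaborates with this file. -/

@[closes "route-MatrixMultiplication-NonabelianARC"] theorem closes (h : NAARCLadder) : MatrixMultiplication := by
  obtain ⟨hM, -⟩ := h
  have key : (2 : ℝ) ^ Literature.Computability.AlgebraicComplexity.omega ℂ = (2 : ℝ) ^ (2 : ℝ) := by
    have h2 := hM 2 (by norm_num)
    rw [Literature.Computability.AlgebraicComplexity.asymptoticRank_matMulTensor ℂ 2 (by norm_num)] at h2
    rw [Real.rpow_two]
    exact_mod_cast h2
  rw [MatrixMultiplication_iff]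
  have hx : (1 : ℝ) < 2 := by norm_num
  exact le_antisymm ((Real.rpow_le_rpow_left_iff hx).mp key.le)
    ((Real.rpow_le_rpow_left_iff hx).mp key.ge)

end Summit.MatrixMultiplication.MatrixMultiplication.Theses.NonabelianARC
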